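import Mathlib
import HarnessLib
import Summits.ValiantsHypothesis.ValiantsHypothesis.Theses.MonotoneRestoration
import Literature.Computability.AlgebraicComplexity.ArithCircuit
import Literature.Computability.AlgebraicComplexity.ArithCircuitProofs
import Literature.Computability.AlgebraicComplexity.MonotoneStructure
import Literature.Computability.AlgebraicComplexity.PermanentIrreducible
import Literature.ModelTheory.FiniteModelTheory.CkEquiv
import Summits.ValiantsHypothesis.ValiantsHypothesis.Theorems.MonotoneRestorationMonotoneRestorationQPCosetCount
import Summits.ValiantsHypothesis.ValiantsHypothesis.Theorems.MonotoneRestorationMonotoneRestorationQPSymmetricLB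
import Summits.ValiantsHypothesis.ValiantsHypothesis.Theorems.MonotoneRestorationMonotoneRestorationQPSupportSymmetrisation
import Summits.ValiantsHypothesis.ValiantsHypothesis.Theorems.MonotoneRestorationMonotoneRestorationQPSparseRegime
import Summits.ValiantsHypothesis.ValiantsHypothesis.Theorems.MonotoneRestorationMonotoneRestorationQPBeta
import Literature.Computability.AlgebraicComplexity.SymmetricArithCircuit
import Literature.Computability.AlgebraicComplexity.DawarWilsenach2025Proofs
import Literature.GroupTheory.PermutationGroups.SmallIndexSubgroups
import Summits.ValiantsHypothesis.ValiantsHypothesis.Theorems.MonotoneRestorationQP.Negative.LoadBearing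
import Summits.ValiantsHypothesis.ValiantsHypothesis.Theorems.MonotoneRestorationMonotoneRestorationQPPermSupportCount

/-! TTRL-lite variant V19015 of stmt-ValiantsHypothesis-15886

Variant `lemma_proposal` of stub `stub_monotoneComputation_of_complexity` (line c2 of crux
`MonotoneRestorationQP`): operand re-indexing.  If a value list `w` agrees with `vals` along the
arithmetic progression `3j + 2` (`w[3j+2] = vals[j]`, junk value `0` on both sides), then the
re-indexed operand (`gate j ↦ gate (3j+2)`, variables and constants unchanged) evaluates against
`w` to the value of the original operand against `vals`.  Used for operands inside the 3-gate
blocks of the monotone restoration and for the output operand.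

Proof: case split on the operand; `var`/`const` are literal, `gate j` is the hypothesis at `j`.
-/

-- `Summit.ValiantsHypothesis.ValiantsHypothesis.…` is the tree's mandated single-conjunct layout
-- (Sub = Summit), so the duplicated namespace component is intended.
set_option linter.dupNamespace false

namespace Summit.ValiantsHypothesis.ValiantsHypothesis.Theorems

open Summit.ValiantsHypothesis.ValiantsHypothesis.Theses.MonotoneRestoration
open Literature.Computability.AlgebraicComplexity

/-- **TTRL-lite variant V19015 of `stub_monotoneComputation_of_complexity`** (operand
re-indexing).  If `w.getD (3 * j + 2) 0 = vals.getD j 0` for every `j`, then evaluating the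
re-indexed operand (`gate j ↦ gate (3 * j + 2)`, `var`/`const` unchanged) against `w` gives the
value of the original operand against `vals`.  Case split on the operand: the `var` and `const`
cases are definitional, the `gate j` case is the hypothesis at `j`.
[cite: Burgisser2000, Def. 2.1 (operand semantics)] -/
theorem stub_monotoneComputation_of_complexity_var19015 :
    ∀ (σ : Type) (vals w : List (MvPolynomial σ NNReal)),
      (∀ j : ℕ, w.getD (3 * j + 2) 0 = vals.getD j 0) →
      ∀ u : ArithCircuit.Operand NNReal σ,
        ArithCircuit.Operand.eval w
          (match u with
            | ArithCircuit.Operand.gate j => ArithCircuit.Operand.gate (3 * j + 2)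
            | v => v) = ArithCircuit.Operand.eval vals u := by
  intro σ vals w h u
  cases u with
  | var i => rfl
  | const c => rfl
  | gate j => exact h j

end Summit.ValiantsHypothesis.ValiantsHypothesis.Theorems
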